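import Summits.Ventures.HSemireg.WedgeHankelPairMixingKernel

/-!
# Venture HSemireg — THE IMAGE OF A KERNEL UNDER A COORDINATE PROJECTION OF THE PAIRS, AS A NAMED SUBSPACE: `Pm(1_T) = proj_{pairs ⊆ T}` (the singular pair mixing keeping the
# factors in `T` IS the monomial projection onto the letters of those pairs), hence `Pm(1_T)(Kr(univ, f, k)) = Kr(univ, f, k) ⊓ Sp(pairs ⊆ T)` and the same for the images
# `V(univ, f, k)` of every transversal class `f` (th-7's `w_N(q)` included), with the complementary splitting `Kr = (Kr ⊓ Sp(pairs ⊆ T)) ⊕ (Kr ⊓ Sp(¬ pairs ⊆ T))`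

HONEST FRAMING. Part of the Lean index of the computation cell `pub-hsemireg` (seat p10 gen 20, Sunday typer «UNIFORM-IN-n»).
Finite-dimensional EXTERIOR ALGEBRA over a field ONLY: no variety, no cohomology theory, no sheaf, no Ext group, no semiregularity map;
nothing here says that HC / HC_CM / HC_AV holds; no Literature fact is declared or used.  Custodian versions as in `WedgeHankelSiegelIdeal` (1/3); the dictionary (`Pm(1_T)` = the
degeneration of the factors outside `T` to a point; the image of the kernel = the kernel classes living on the sub-product over `T`) is QUOTED, never asserted.

WHAT IS IN THE TREE.  I5 (`WedgeHankelPairMixingKernel`): `Pm_diagonal_mem_Kr` / `Pm_diagonal_mem_V` (every diagonal pair scaling, zeros allowed, maps `Kr(univ, f, k)` and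
`V(univ, f, k)` into themselves for a transversal `f`), `Pm_mem_Kr_w` (every `M`); I2 `Pm_diagonal_B` (`Pm (diagonal d) E_s = (Π_{i∈s} d_{pr i})·E_s`); gen-5 `WedgeWeilSpan`: `Sp P`,
`proj P` (`proj_B`, `proj_mem`, `proj_eq_self`, `proj_add_proj_not`, `Sp_inf_Sp_eq_bot`).  I5's «NOT typed here» names the gap: the image `Pm M (Kr)` for a singular `M` as a named
subspace.  THIS FILE (namespace `Summit.Ventures.HSemireg.Wedge.HankelPairMixing` continued; imports I5) fills it for the coordinate projections `M = diagonal 1_T`, `T ⊆ [N]`: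
* §233 **`Pm_diagonal_indicator_apply`: `Pm (diagonal 1_T) θ = proj_{∀ i ∈ s, pr i ∈ T} θ`** for every form `θ` (the two linear maps agree on monomials: `Finset.prod_boole`),
  `Pm_diagonal_indicator_toLinearMap`.
* §234 for any predicate `P` and any subspace `W` stable under `proj P`: **`map_proj_eq_inf_Sp`** (`proj P (W) = W ⊓ Sp P`), `proj_not_mem_of_proj_mem` (stability under `proj ¬P`),
  **`eq_inf_Sp_sup_inf_Sp_not`** (`W = (W ⊓ Sp P) ⊔ (W ⊓ Sp ¬P)`) and `inf_Sp_disjoint_inf_Sp_not`.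
* §235 THE NAMED IMAGES: **`map_Pm_indicator_Kr`: `Pm(1_T)(Kr(univ, f, k)) = Kr(univ, f, k) ⊓ Sp(pairs ⊆ T)`** and **`map_Pm_indicator_V`** (the same for `V(univ, f, k)`) for every
  TRANSVERSAL `f`, every `k`, every field; the class forms **`map_Pm_indicator_Kr_w` / `map_Pm_indicator_V_w`** (`f = w_N(q)`); the splittings **`Kr_eq_inf_pairs_sup_inf_not_pairs`** /
  `V_eq_inf_pairs_sup_inf_not_pairs` (`Kr = (Kr ⊓ Sp(pairs ⊆ T)) ⊔ (Kr ⊓ Sp(¬ pairs ⊆ T))`, the two parts disjoint).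
NOT typed here: a general singular `M` (the image is `Pm(M)(Kr)`, a subspace of `Kr` by I5, equal to `Kr ⊓ Sp(pairs ⊆ im M)` only after a change of frame in the factors);
the dimension of `Kr ⊓ Sp(pairs ⊆ T)` (I10's fibre sums restricted to pair types supported in `T`); anything Ext-side.  Class side only; new names only.
-/

open Module

namespace Summit.Ventures.HSemireg.Wedge.HankelPairMixing

open Summit.Ventures.HSemireg.Wedge Summit.Ventures.HSemireg.Wedge.Kunneth Summit.Ventures.HSemireg.Wedge.Hankel
  Summit.Ventures.HSemireg.Wedge.KunnethKernel Summit.Ventures.HSemireg.Wedge.Weil Summit.Ventures.HSemireg.Wedge.HankelPairGrading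

variable (K : Type*) [Field K] {N : ℕ}

/-! ## §233. A coordinate projection of the pairs is the monomial projection onto the letters of the kept pairs -/

/-- **`Pm (diagonal 1_T) θ = proj_{pairs ⊆ T} θ`**: the pair mixing keeping the factors in `T` and killing the others IS the coordinate projection onto the monomials all of whose
letters lie in pairs of `T` (both are linear and agree on every monomial `E_s`: `Π_{i∈s} 1_T(pr i) = [∀ i ∈ s, pr i ∈ T]`). -/
theorem Pm_diagonal_indicator_apply (T : Finset (Fin N)) (θ : HT K (In N)) :
    Pm K (Matrix.diagonal fun c => if c ∈ T then (1 : K) else 0) θ = proj (K := K) (fun s : Finset (In N) => ∀ i ∈ s, pr i ∈ T) θ := by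
  classical
  have h : (Pm K (Matrix.diagonal fun c => if c ∈ T then (1 : K) else 0)).toLinearMap = proj (K := K) (fun s : Finset (In N) => ∀ i ∈ s, pr i ∈ T) :=
    (B K (In N)).ext fun s => by
      rw [AlgHom.toLinearMap_apply, Pm_diagonal_B, proj_B, Finset.prod_boole]
      split_ifs with hs
      · rw [one_smul]
      · rw [zero_smul]
  exact LinearMap.congr_fun h θ

/-- the same as an identity of linear maps. -/
theorem Pm_diagonal_indicator_toLinearMap (T : Finset (Fin N)) :
    (Pm K (Matrix.diagonal fun c => if c ∈ T then (1 : K) else 0)).toLinearMap = proj (K := K) (fun s : Finset (In N) => ∀ i ∈ s, pr i ∈ T) :=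
  LinearMap.ext (Pm_diagonal_indicator_apply K T)

/-! ## §234. The image of a projection-stable subspace under a monomial projection -/

section ProjStable

variable {I : Type*} [LinearOrder I] [Fintype I]

/-- **a subspace stable under `proj P` is mapped by `proj P` ONTO its part supported on `P`: `proj P (W) = W ⊓ Sp P`.** -/
theorem map_proj_eq_inf_Sp (P : Finset I → Prop) [DecidablePred P] {W : Submodule K (HT K I)} (hW : ∀ θ ∈ W, proj (K := K) P θ ∈ W) :
    W.map (proj (K := K) P) = W ⊓ Sp K P := by
  apply le_antisymm
  · rintro _ ⟨θ, hθ, rfl⟩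
    exact ⟨hW θ hθ, proj_mem P θ⟩
  · rintro v ⟨hvW, hvP⟩
    exact ⟨v, hvW, proj_eq_self (fun s hs => hs) hvP⟩

/-- stability under `proj P` gives stability under the complementary projection `proj ¬P = 1 − proj P`. -/
theorem proj_not_mem_of_proj_mem (P : Finset I → Prop) [DecidablePred P] {W : Submodule K (HT K I)} (hW : ∀ θ ∈ W, proj (K := K) P θ ∈ W) {θ : HT K I} (hθ : θ ∈ W) :
    proj (K := K) (fun s => ¬ P s) θ ∈ W := by
  have h := proj_add_proj_not (K := K) P θ
  rw [← eq_sub_iff_add_eq'] at h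
  rw [h]
  exact Submodule.sub_mem _ hθ (hW θ hθ)

/-- **a `proj P`-stable subspace splits along `P`: `W = (W ⊓ Sp P) ⊔ (W ⊓ Sp ¬P)`.** -/
theorem eq_inf_Sp_sup_inf_Sp_not (P : Finset I → Prop) [DecidablePred P] {W : Submodule K (HT K I)} (hW : ∀ θ ∈ W, proj (K := K) P θ ∈ W) :
    W = (W ⊓ Sp K P) ⊔ (W ⊓ Sp K (fun s => ¬ P s)) := by
  apply le_antisymm
  · intro θ hθ
    rw [← proj_add_proj_not (K := K) P θ]
    exact Submodule.add_mem_sup ⟨hW θ hθ, proj_mem P θ⟩ ⟨proj_not_mem_of_proj_mem K P hW hθ, proj_mem _ θ⟩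
  · exact sup_le inf_le_left inf_le_left

/-- … and the two parts meet trivially. -/
theorem inf_Sp_disjoint_inf_Sp_not (P : Finset I → Prop) (W : Submodule K (HT K I)) :
    Disjoint (W ⊓ Sp K P) (W ⊓ Sp K (fun s => ¬ P s)) := by
  rw [disjoint_iff, ← le_bot_iff]
  calc (W ⊓ Sp K P) ⊓ (W ⊓ Sp K fun s => ¬ P s) ≤ Sp K P ⊓ Sp K (fun s => ¬ P s) := inf_le_inf inf_le_right inf_le_right
    _ = ⊥ := Sp_inf_Sp_eq_bot (fun s hs hns => hns hs)

end ProjStable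

/-! ## §235. The named images `Pm(1_T)(Kr)` and `Pm(1_T)(V)` -/

/-- **`Pm(1_T)(Kr(univ, f, k)) = Kr(univ, f, k) ⊓ Sp(pairs ⊆ T)`** for every TRANSVERSAL class `f` (`f ∈ Sp(Tr)`), every `k`, every `T ⊆ [N]`: the image of the kernel under the
coordinate projection of the pairs is the part of the kernel supported on the letters of the kept pairs (I5 `Pm_diagonal_mem_Kr` gives the stability; §233–§234 name the image). -/
theorem map_Pm_indicator_Kr (T : Finset (Fin N)) {f : HT K (In N)} (hf : f ∈ Sp K (Tr (N := N))) (k : ℕ) :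
    (Kr K Finset.univ f k).map (Pm K (Matrix.diagonal fun c => if c ∈ T then (1 : K) else 0)).toLinearMap =
      Kr K Finset.univ f k ⊓ Sp K (fun s : Finset (In N) => ∀ i ∈ s, pr i ∈ T) := by
  rw [Pm_diagonal_indicator_toLinearMap]
  exact map_proj_eq_inf_Sp K _ fun θ hθ => by rw [← Pm_diagonal_indicator_apply]; exact Pm_diagonal_mem_Kr K _ hf hθ

/-- **`Pm(1_T)(V(univ, f, k)) = V(univ, f, k) ⊓ Sp(pairs ⊆ T)`** for every transversal `f` (I5 `Pm_diagonal_mem_V`). -/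
theorem map_Pm_indicator_V (T : Finset (Fin N)) {f : HT K (In N)} (hf : f ∈ Sp K (Tr (N := N))) (k : ℕ) :
    (V K (In N) Finset.univ f k).map (Pm K (Matrix.diagonal fun c => if c ∈ T then (1 : K) else 0)).toLinearMap =
      V K (In N) Finset.univ f k ⊓ Sp K (fun s : Finset (In N) => ∀ i ∈ s, pr i ∈ T) := by
  rw [Pm_diagonal_indicator_toLinearMap]
  exact map_proj_eq_inf_Sp K _ fun v hv => by rw [← Pm_diagonal_indicator_apply]; exact Pm_diagonal_mem_V K _ hf hv

/-- **th-7's class: `Pm(1_T)(Kr(univ, w_N q, k)) = Kr(univ, w_N q, k) ⊓ Sp(pairs ⊆ T)`** (every `q`, `k`, `T`, every field). -/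
theorem map_Pm_indicator_Kr_w (T : Finset (Fin N)) (q : ℕ → K) (k : ℕ) :
    (Kr K Finset.univ (w K N N q) k).map (Pm K (Matrix.diagonal fun c => if c ∈ T then (1 : K) else 0)).toLinearMap =
      Kr K Finset.univ (w K N N q) k ⊓ Sp K (fun s : Finset (In N) => ∀ i ∈ s, pr i ∈ T) :=
  map_Pm_indicator_Kr K T (w_mem_Sp_Tr K q) k

/-- **th-7's class: `Pm(1_T)(V(univ, w_N q, k)) = V(univ, w_N q, k) ⊓ Sp(pairs ⊆ T)`.** -/
theorem map_Pm_indicator_V_w (T : Finset (Fin N)) (q : ℕ → K) (k : ℕ) :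
    (V K (In N) Finset.univ (w K N N q) k).map (Pm K (Matrix.diagonal fun c => if c ∈ T then (1 : K) else 0)).toLinearMap =
      V K (In N) Finset.univ (w K N N q) k ⊓ Sp K (fun s : Finset (In N) => ∀ i ∈ s, pr i ∈ T) :=
  map_Pm_indicator_V K T (w_mem_Sp_Tr K q) k

/-- **THE KERNEL SPLITS ALONG ANY SET OF PAIRS: `Kr(univ, f, k) = (Kr ⊓ Sp(pairs ⊆ T)) ⊔ (Kr ⊓ Sp(¬ pairs ⊆ T))`** for a transversal `f` — the part living on the sub-product
over `T` and the part involving at least one letter outside `T`. -/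
theorem Kr_eq_inf_pairs_sup_inf_not_pairs (T : Finset (Fin N)) {f : HT K (In N)} (hf : f ∈ Sp K (Tr (N := N))) (k : ℕ) :
    Kr K Finset.univ f k = (Kr K Finset.univ f k ⊓ Sp K (fun s : Finset (In N) => ∀ i ∈ s, pr i ∈ T)) ⊔
      (Kr K Finset.univ f k ⊓ Sp K (fun s : Finset (In N) => ¬ ∀ i ∈ s, pr i ∈ T)) := by
  classical
  exact eq_inf_Sp_sup_inf_Sp_not K _ fun θ hθ => by rw [← Pm_diagonal_indicator_apply]; exact Pm_diagonal_mem_Kr K _ hf hθ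

/-- the same splitting for the images `V(univ, f, k)`. -/
theorem V_eq_inf_pairs_sup_inf_not_pairs (T : Finset (Fin N)) {f : HT K (In N)} (hf : f ∈ Sp K (Tr (N := N))) (k : ℕ) :
    V K (In N) Finset.univ f k = (V K (In N) Finset.univ f k ⊓ Sp K (fun s : Finset (In N) => ∀ i ∈ s, pr i ∈ T)) ⊔
      (V K (In N) Finset.univ f k ⊓ Sp K (fun s : Finset (In N) => ¬ ∀ i ∈ s, pr i ∈ T)) := by
  classical
  exact eq_inf_Sp_sup_inf_Sp_not K _ fun v hv => by rw [← Pm_diagonal_indicator_apply]; exact Pm_diagonal_mem_V K _ hf hv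

end Summit.Ventures.HSemireg.Wedge.HankelPairMixing
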